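import Mathlib

/-!
# Route EIHFluxBalance — crux `InertialRecession`, line `sublinear-is-free-clean-window-charges`:
# intruder PASSAGES past a slow pair — the bad set is an interval, it is short, and the pair distance is frozen on it

Helper file for the crux `stmt-FinalStateConjecture-10166`
(`Summit.FinalStateConjecture.FinalStateConjecture.Theses.EIHFluxBalance.InertialRecession`), registered stub `stub_incrementOracle`
(lead reshape r9/r10) of `Cruxes/InertialRecession/Lines/sublinear_is_free_clean_window_charges.lean` (lead's roadmap §8, case `|S| = 2`).

A slow pair `{k, l}` (pair distance `d` with `|d(s′) − d(s)| ≤ σ(s′ − s)`) loses its common window exactly while a ballistic intruder `m`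
(proxy coordinate `x = ⟪ξₘ − ξₖ, n⟫` with `x(s′) − x(s) ≥ (W/2)(s′ − s)`) satisfies `|x| < 3d`. With `f = |x| − 3d`:
* `ordConnected_passageSet` — if `0 ≤ 6σ < W` then `{s ∈ [a,b] | f s < 0}` is an interval (`f` is unimodal);
* `passage_length_le` — if `f < 0` at both ends of `[α,β]` and `26·3σ ≤ W` then `β − α ≤ 13·d(α)/W`;
* `passage_dist_frozen` — consequently `|d(s) − d(α)| ≤ (13σ/W)·d(α)` on `[α,β]`.
-/

noncomputable section

set_option linter.dupNamespace false

open Set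

namespace Summit.FinalStateConjecture.FinalStateConjecture.Theorems.SublinearIsFree.Oracle

/-- **THE PASSAGE SET IS AN INTERVAL.** See the module docstring. [folklore] -/
theorem ordConnected_passageSet {x d : ℝ → ℝ} {a b W σ : ℝ} (hσ : 0 ≤ σ) (hW : 6 * σ < W)
    (hx : ∀ s ∈ Icc a b, ∀ s' ∈ Icc a b, s ≤ s' → W / 2 * (s' - s) ≤ x s' - x s)
    (hd : ∀ s ∈ Icc a b, ∀ s' ∈ Icc a b, s ≤ s' → |d s' - d s| ≤ σ * (s' - s)) :
    OrdConnected {s | s ∈ Icc a b ∧ |x s| - 3 * d s < 0} := by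
  refine ⟨fun s₁ h₁ s₃ h₃ s₂ h₂ ↦ ?_⟩
  obtain ⟨h₁ab, hf₁⟩ := h₁
  obtain ⟨h₃ab, hf₃⟩ := h₃
  have hs₂ : s₂ ∈ Icc a b := ⟨h₁ab.1.trans h₂.1, h₂.2.trans h₃ab.2⟩
  refine ⟨hs₂, ?_⟩
  have hW0 : 0 < W := by linarith
  by_cases hx0 : x s₂ ≤ 0
  · -- compare with `s₁`: there `x` is even more negative
    have h12 := hx s₁ h₁ab s₂ hs₂ h₂.1
    have hd12 := hd s₁ h₁ab s₂ hs₂ h₂.1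
    have hgain : 0 ≤ W / 2 * (s₂ - s₁) := by nlinarith [h₂.1]
    have hx1 : x s₁ ≤ 0 := by linarith
    rw [abs_of_nonpos hx0]
    rw [abs_of_nonpos hx1] at hf₁
    rw [abs_le] at hd12
    nlinarith [hd12.1, hd12.2, h₂.1]
  · push Not at hx0
    have h23 := hx s₂ hs₂ s₃ h₃ab h₂.2
    have hd23 := hd s₂ hs₂ s₃ h₃ab h₂.2
    have hgain : 0 ≤ W / 2 * (s₃ - s₂) := by nlinarith [h₂.2]
    have hx3 : 0 ≤ x s₃ := by linarith
    rw [abs_of_pos hx0]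
    rw [abs_of_nonneg hx3] at hf₃
    rw [abs_le] at hd23
    nlinarith [hd23.1, hd23.2, h₂.2]

/-- **PASSAGES ARE SHORT.** If `|x| < 3d` at `α` and at `β ≥ α`, `x` gains at least `(W/2)(β − α)`, `d` moves by at most `σ(β − α)` and
`78σ ≤ W`, `0 < W`, then `β − α ≤ 13·d(α)/W`. [folklore] -/
theorem passage_length_le {x d : ℝ → ℝ} {α β W σ : ℝ} (hW : 0 < W) (hσ : 78 * σ ≤ W) (hαβ : α ≤ β)
    (hx : W / 2 * (β - α) ≤ x β - x α) (hd : |d β - d α| ≤ σ * (β - α))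
    (hα : |x α| < 3 * d α) (hβ : |x β| < 3 * d β) : β - α ≤ 13 * d α / W := by
  rw [abs_lt] at hα hβ
  rw [abs_le] at hd
  rw [le_div_iff₀ hW]
  nlinarith

/-- **THE PAIR DISTANCE IS FROZEN DURING A PASSAGE**: on `[α, β]` with `β − α ≤ 13·d(α)/W`, `|d(s) − d(α)| ≤ (13σ/W)·d(α)`.
[folklore] -/
theorem passage_dist_frozen {d : ℝ → ℝ} {α β W σ : ℝ} (hW : 0 < W) (hσ0 : 0 ≤ σ) (hlen : β - α ≤ 13 * d α / W)
    (hd : ∀ s ∈ Icc α β, |d s - d α| ≤ σ * (s - α)) :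
    ∀ s ∈ Icc α β, |d s - d α| ≤ 13 * σ / W * d α := by
  intro s hs
  refine (hd s hs).trans ?_
  have h1 : s - α ≤ 13 * d α / W := by linarith [hs.2]
  calc σ * (s - α) ≤ σ * (13 * d α / W) := mul_le_mul_of_nonneg_left h1 hσ0
    _ = 13 * σ / W * d α := by field_simp

/-- Registered helper form of `passage_length_le` (carrier of this file). [folklore] -/
theorem oracle_passage_length_le : ∀ (x d : ℝ → ℝ) (α β W σ : ℝ), 0 < W → 78 * σ ≤ W → α ≤ β →
    W / 2 * (β - α) ≤ x β - x α → |d β - d α| ≤ σ * (β - α) → |x α| < 3 * d α → |x β| < 3 * d β →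
    β - α ≤ 13 * d α / W :=
  fun _ _ _ _ _ _ hW hσ hαβ hx hd hα hβ ↦ passage_length_le hW hσ hαβ hx hd hα hβ

end Summit.FinalStateConjecture.FinalStateConjecture.Theorems.SublinearIsFree.Oracle

end
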